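import Summits.BirchSwinnertonDyer.BirchSwinnertonDyer.Theorems.UniversalToricDescentRationalSplitIMCInclusionAtThreeClosedModuloV87
import Summits.BirchSwinnertonDyer.BirchSwinnertonDyer.Theorems.UniversalToricDescentToricFrameExistsDefs
import HarnessLib

/-!
# The rational wall `RationalSplitIMCInclusionAtThree` (stmt-BirchSwinnertonDyer-24207) CLOSED MODULO FOUR NAMED STATEMENTS, v11 form
# (certificate `V88` = the glue of line `ratwall_thin_comb` v11 with EVERY input BY NAME; `--supports stmt-BirchSwinnertonDyer-24207`;
# cell `pub/bsd-wall`, LEAD `cruxlead-24207` g38)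

WHY THIS FILE. Twin of `…ClosedModuloV86` (g36) for skeleton v11: after the FRAME FUNCTIONAL EQUATION (`…ThinComb.FrameFunctionalEquation`, g38)
the first stub of the line is the BARE existence (E) of a ♯♯-frame, named by the route-independent `@[conjecture]` constant
`…Theorems.UniversalToricDescentToricFrameExistsDefs.ToricFrameExistsAtThree` (p777072); K2-rat is the route item stmt-BirchSwinnertonDyer-32493
`…Theses.UniversalToricDescent.RatThinCombDvdUpToTwoAtThree`; the two print inputs are the typed Literature facts
`jacquet1972_functionalEquation_rankinSelbergHecke_cone` and `nekovar2006_xGr₂_isTorsion_iff_and_charIdeal_eq_map_inv`. This file states the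
composition ONCE with the four names as hypotheses — the shape a planner's by-name glue closes in one line, and the shape in which refuters,
typers and the ladder read what the rational wall still owes:

* `RationalSplitIMCInclusionAtThree_of_named` :
  `ToricFrameExistsAtThree → jacquet1972_… → nekovar2006_… → RatThinCombDvdUpToTwoAtThree → RationalSplitIMCInclusionAtThree`
  (= `V87.RationalSplitIMCInclusionAtThree_of_exists_of_jacquet_of_nekovar_of_ratCombDvd`, the constants unfolding definitionally).

Compared with V86 the first hypothesis is WEAKER: (N♭) ⟹ (E) (`V87.toricFrameExists_of_normalisedUpToUnit`), and (E) is exactly «there is an object of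
the hypothesis type of item 32493». HONEST SCOPE: an implication between named open statements; it proves none of them; crux 24207 stays OPEN
(conditional-result); BSD is proved for no curve; 24207 / 20395 / 20186 / 32493 OPEN.

References: [cite: Hida1988AIF, §5 Thm. 5.1b] [cite: Jacquet1972, §19 Thm. 19.14, Cor. 19.15] [cite: Nekovar2006, Thm. 8.9.9, Prop. 9.6.6 (ii)]
[cite: Gu2025FiniteSlopeUniversalRS, Conj. 2.15 (arXiv:2512.01184)] [cite: HaoLoeffler2025, §4 Thm. 4.9 (arXiv:2405.12611)]
-/

set_option linter.dupNamespace false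
set_option autoImplicit false

noncomputable section

namespace Summit.BirchSwinnertonDyer.BirchSwinnertonDyer.Theorems.UniversalToricDescentRatwallThinCombLine.V88

/-- **THE RATIONAL WALL FROM FOUR NAMED STATEMENTS (v11)**: the bare toric existence (E) (`@[conjecture]` constant, adaptation of Hida 1988 Thm. 5.1b
at the additive split `3`), Jacquet's cone functional equation (print), Nekovář's two-variable algebraic functional equation (print), and the rational
thin-comb divisibility K2-rat (route item 32493, research) imply `RationalSplitIMCInclusionAtThree` — the V87 certificate with its two ∀-hypotheses
replaced by their names. [cite: Hida1988AIF, §5 Thm. 5.1b] [cite: Jacquet1972, §19 Thm. 19.14, Cor. 19.15]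
[cite: Nekovar2006, Thm. 8.9.9, Prop. 9.6.6 (ii)] [cite: Gu2025FiniteSlopeUniversalRS, Conj. 2.15 (arXiv:2512.01184)] -/
theorem RationalSplitIMCInclusionAtThree_of_named
    (hE : Summit.BirchSwinnertonDyer.BirchSwinnertonDyer.Theorems.UniversalToricDescentToricFrameExistsDefs.ToricFrameExistsAtThree)
    (hJ : Literature.NumberTheory.EllipticCurves.jacquet1972_functionalEquation_rankinSelbergHecke_cone)
    (hNek : Literature.NumberTheory.EllipticCurves.nekovar2006_xGr₂_isTorsion_iff_and_charIdeal_eq_map_inv)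
    (hK2 : Summit.BirchSwinnertonDyer.BirchSwinnertonDyer.Theses.UniversalToricDescent.RatThinCombDvdUpToTwoAtThree) :
    Summit.BirchSwinnertonDyer.BirchSwinnertonDyer.Theses.UniversalToricDescent.RationalSplitIMCInclusionAtThree :=
  V87.RationalSplitIMCInclusionAtThree_of_exists_of_jacquet_of_nekovar_of_ratCombDvd hE hJ hNek hK2

end Summit.BirchSwinnertonDyer.BirchSwinnertonDyer.Theorems.UniversalToricDescentRatwallThinCombLine.V88

end
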